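import Summits.Ventures.YMGap.RobustBall.LocalSourceScreeningMetric
import Summits.Ventures.YMGap.RobustBall.UniformMassGapKR
import HarnessLib

/-!
# Venture YMGap, track ROBUST-BALL (Y2) — local sources are screened at the clustering rate, UNIFORMLY ON THE
# TIER-1 BALL: the pair door, `SU(2)` closed form, cells, the Wilson point, every `N`

HONEST FRAMING. WHAT THIS IS: a venture file (cell `pub-ymgap`, track Y2 ROBUST-BALL, seat rb-p1, theorems only)
closing the screening estimate of `LocalSourceScreening[Metric].lean` with the landed one-link doors, so that the
constants are explicit and MEMBER-INDEPENDENT on rb-p1's tier-1 `ℤ^d` ball `MemBallZd ε₀ ε₁ R`: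
* `localScreening_of_pair` — for `d, N ≥ 1` and a one-link Poincaré/variance pair `(c, v)` on `‖B‖_op ≤ b ⊇ 2(d−1)|β|`
  with `6(d−1)|β| e^{ε₀} √(c v) + e^{ε₀/2} √c ε₁ ≤ ρ < 1` (the door of `UniformMassGapKR`): for EVERY member `(W, supp)`
  of the ball, EVERY bounded source `V` loading only the links of a finite set `S` (oscillation loads `≤ B`; ANY
  strength, ANY range), every DLR state `μ` of the member, EVERY DLR state `ν` of `W + V`, and every Lipschitz
  cylinder observable `F` (`Λ`, `K_F`):
  `|∫ F dμ − ∫ F dν| ≤ (√N/2 · min(B,4))/(1 − max(ρ,½)) · e^{κ} · e^{−(κ/max(1,R)) d(Λ,S)} · #Λ · K_F`,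
  `κ = −log max(ρ, 1/2)` — the SAME rate as the uniform clustering rows; clean reading `…_linear`
  (`1/2 ≤ ρ < 1`: `√N · min(B,4)/(1 − ρ) · e^{−((1−ρ)/max(1,R)) d(Λ,S)} · #Λ · K_F`);
* `SU(2)`, every `d`, hypothesis-free (sharp Poincaré constant `2/3`): `su2_localScreening[_dim4]` —
  `2(d−1)|β_W| e^{ε₀} + e^{ε₀/2} √(2/3) ε₁ ≤ ρ`, `1/2 ≤ ρ < 1 ⇒ √2 · min(B,4)/(1 − ρ) · e^{−((1−ρ)/max(1,R)) d(Λ,S)} · #Λ · K_F`;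
  cell `(β_W; ε₀, ε₁; ρ) = (1/8; 1/10, 1/20; 7/8)`;
* THE WILSON POINT `su2_wilson_localScreening_upTo_oneTwelfth`: for `0 ≤ β_W ≤ 1/12`, ANY bounded source `V` on top of
  the pure `SU(2)` Wilson action on `ℤ⁴`, every Wilson DLR state `μ` and every DLR state `ν` of `Wilson + V`:
  `|∫ F dμ − ∫ F dν| ≤ √2 · min(B,4) · 2^{−⌊d(Λ,S)⌋} · #Λ · K_F ≤ 4√2 · 2^{−⌊d(Λ,S)⌋} · #Λ · K_F`;
* every `N ≥ 2` (Bakry–Émery pair, hypothesis-free): `suN_localScreening_bakryEmery`.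
READING (class K, strong coupling): on the certified ball a static source — a Wilson loop of any size and strength,
couplings changed on a bounded region, any bounded gauge-invariant insertion — is INVISIBLE beyond the certified
correlation length: its effect on a local observable at distance `D` is `O(e^{−m D})` with the clustering rate `m` of
the uniform rows and a constant that does not see the source's strength.  WHAT THIS IS NOT: a one-sided
Dobrushin-comparison bound (the physical screening length may be shorter); nothing about uniqueness for the modified
action; lattice strong-coupling statements, nothing about the continuum limit or a Clay-sense mass gap.
-/

noncomputable section

open MeasureTheory Filter Function ProbabilityTheory Real Topology
open scoped NNReal
open Literature.Probability.LatticeModels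
open Literature.Probability.LatticeModels.DobrushinMetric
open Literature.MathematicalPhysics.QuantumLattice
open Literature.MathematicalPhysics.QuantumFieldTheory hiding ZdEdge Site
open Summit.QuantumFields.BalabanUV.InfraRed.StrongCouplingPoincareDoorSUN (OneLinkPoincareSUN
  oneLinkPoincareSUN_two_sharp oneLinkPoincareSUN_bakryEmery)
open Summit.QuantumFields.BalabanUV.InfraRed.StrongCouplingVarianceDoorSUN (OneLinkVarianceBound
  oneLinkVarianceBound_bakryEmery)

namespace Summit.Ventures.YMGap.RobustBall

variable {d N : ℕ}

/-! ### The ball: screening of local sources from a one-link pair -/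

/-- **LOCAL SOURCES ARE SCREENED, UNIFORMLY ON THE TIER-1 BALL, from a one-link pair.**  `d, N ≥ 1`; a Poincaré /
variance pair `(c, v)` of the unperturbed `SU(N)` one-link family on `‖B‖_op ≤ b`, `b ≥ 2(d−1)|β|`;
`6(d−1)|β| e^{ε₀} √(c v) + e^{ε₀/2} √c ε₁ ≤ ρ < 1`.  Then for EVERY member `(W, supp) ∈ MemBallZd ε₀ ε₁ R`, every bounded
adapted source `(V, suppV)` with one-link oscillation loads `≤ bV ≤ B` vanishing off the finite link set `S`, every DLR
state `μ` of the member, every DLR state `ν` of `W + V`, and every Lipschitz cylinder `F` (`Λ`, `K_F`):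
`|∫ F dμ − ∫ F dν| ≤ (√N/2 · min(B,4))/(1 − max(ρ,½)) · e^{κ} · e^{−(κ/max(1,R)) d(Λ,S)} · #Λ · K_F`, `κ = −log max(ρ,½)`. -/
theorem localScreening_of_pair (hd : 1 ≤ d) (hN : 1 ≤ N) {β b c v ε₀ ε₁ ρ R : ℝ} (hc : 0 ≤ c) (hv : 0 ≤ v)
    (hb : |β| * (2 * ((d : ℝ) - 1)) ≤ b)
    (hP : ∀ B : Matrix (Fin N) (Fin N) ℂ, matrixOpNorm B ≤ b →
      ∀ (ψ : Matrix.specialUnitaryGroup (Fin N) ℂ → ℝ) (M : ℝ), 0 ≤ M →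
        (∀ x y, |ψ x - ψ y| ≤ M * suFrobDist x y) →
        Var[ψ; (haarProbability (Matrix.specialUnitaryGroup (Fin N) ℂ)).tilted
          fun g => (N : ℝ) * ((g : Matrix (Fin N) (Fin N) ℂ) * B).trace.re] ≤ c * M ^ 2)
    (hVB : ∀ B : Matrix (Fin N) (Fin N) ℂ, matrixOpNorm B ≤ b → ∀ Δ : Matrix (Fin N) (Fin N) ℂ,
      Var[fun g : Matrix.specialUnitaryGroup (Fin N) ℂ =>
          (N : ℝ) * ((g : Matrix (Fin N) (Fin N) ℂ) * Δ).trace.re;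
        (haarProbability (Matrix.specialUnitaryGroup (Fin N) ℂ)).tilted
          fun g => (N : ℝ) * ((g : Matrix (Fin N) (Fin N) ℂ) * B).trace.re] ≤ v * frobNorm Δ ^ 2)
    (hρ : 6 * ((d : ℝ) - 1) * |β| * (exp ε₀ * Real.sqrt (c * v)) + exp (ε₀ / 2) * Real.sqrt c * ε₁ ≤ ρ)
    (hρ1 : ρ < 1)
    {W : Potential (ZdEdge d) (Matrix.specialUnitaryGroup (Fin N) ℂ)}
    {supp : Finset (ZdEdge d) → Finset (Finset (ZdEdge d))} (hmem : MemBallZd ε₀ ε₁ R W supp)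
    {V : Potential (ZdEdge d) (Matrix.specialUnitaryGroup (Fin N) ℂ)} (hV : V.IsAdapted)
    (hVb : ∀ X, ∃ C, ∀ U, |V X U| ≤ C)
    {suppV : Finset (ZdEdge d) → Finset (Finset (ZdEdge d))} (hsuppV : V.IsSupportedBy suppV)
    {oscV : Finset (ZdEdge d) → ZdEdge d → ℝ} (hoscV : ∀ X, Dobrushin.IsOscBound (V X) (oscV X))
    {bV : ZdEdge d → ℝ} (hbV : ∀ e, ∑ X ∈ (suppV {e}).filter (fun X => e ∈ X), oscV X e ≤ bV e)
    {B : ℝ} (hB : ∀ e, bV e ≤ B) {S : Finset (ZdEdge d)} (hS : ∀ e, e ∉ S → bV e ≤ 0)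
    {μ ν : Measure (LGConfig d (Matrix.specialUnitaryGroup (Fin N) ℂ))}
    (hμ : μ ∈ perturbedGibbsMeasures (d := d) (fundamentalRep (Fin N)) (N * β) W supp)
    (hν : ν ∈ perturbedGibbsMeasures (d := d) (fundamentalRep (Fin N)) (N * β) (W + V)
      (fun Λ => supp Λ ∪ suppV Λ))
    {F : LGConfig d (Matrix.specialUnitaryGroup (Fin N) ℂ) → ℝ} {Λ : Finset (ZdEdge d)} {KF : ℝ≥0}
    (hF : IsLipschitzCylinder (fundamentalRep (Fin N)) F Λ KF) :
    |(∫ σ, F σ ∂μ) - ∫ σ, F σ ∂ν| ≤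
      Real.sqrt N / 2 * min B 4 / (1 - max ρ (1 / 2)) * exp (-Real.log (max ρ (1 / 2))) *
        exp (-(-Real.log (max ρ (1 / 2)) / max 1 R) * setDistEdges Λ S) * (Λ.card * KF) := by
  haveI : SecondCountableTopology (Matrix (Fin N) (Fin N) ℂ) :=
    inferInstanceAs (SecondCountableTopology (Fin N → Fin N → ℂ))
  haveI : SecondCountableTopology (Matrix.specialUnitaryGroup (Fin N) ℂ) :=
    Topology.IsEmbedding.subtypeVal.secondCountableTopology
  obtain ⟨osc, lip, hosc, hlip, hosca, hΛ⟩ := hmem.loads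
  have hW : W.IsAdapted := fun X => ⟨hmem.dependsOn X, (hmem.continuous X).measurable⟩
  have hWb : ∀ X, ∃ C, ∀ U, |W X U| ≤ C := fun X => exists_bound_of_continuous (hmem.continuous X)
  have hKR := isKRContraction_perturbedYM_SU hd hN hc hv hb hP hVB hW (supp := supp) hosc hosca hlip
  have hrow : ∀ x, ∑ y ∈ perturbedNbr supp x,
      (exp ε₀ * Real.sqrt (c * v) * |β| * linkInfluence x y +
        exp (ε₀ / 2) * Real.sqrt c * ∑ X ∈ (supp {x}).filter (fun X => x ∈ X), lip X y) ≤ ρ :=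
    fun x => (sum_perturbedNbr_coeff_le hd (β := β) (c := c) (v := v) (a := ε₀) hΛ x).trans hρ
  exact abs_integral_sub_integral_le_of_source_cylinder hd hW hWb hmem.supportedBy hmem.range hKR hrow hρ1 hV hVb
    hsuppV hoscV hbV hB hS hμ hν hF

/-- **Clean reading, `1/2 ≤ ρ < 1`**: constant `√N · min(B,4)/(1 − ρ)`, rate `(1 − ρ)/max(1, R)`:
`|∫ F dμ − ∫ F dν| ≤ √N · min(B,4)/(1 − ρ) · e^{−((1−ρ)/max(1,R)) d(Λ,S)} · #Λ · K_F`. -/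
theorem localScreening_of_pair_linear (hd : 1 ≤ d) (hN : 1 ≤ N) {β b c v ε₀ ε₁ ρ R : ℝ} (hc : 0 ≤ c)
    (hv : 0 ≤ v) (hb : |β| * (2 * ((d : ℝ) - 1)) ≤ b)
    (hP : ∀ B : Matrix (Fin N) (Fin N) ℂ, matrixOpNorm B ≤ b →
      ∀ (ψ : Matrix.specialUnitaryGroup (Fin N) ℂ → ℝ) (M : ℝ), 0 ≤ M →
        (∀ x y, |ψ x - ψ y| ≤ M * suFrobDist x y) →
        Var[ψ; (haarProbability (Matrix.specialUnitaryGroup (Fin N) ℂ)).tilted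
          fun g => (N : ℝ) * ((g : Matrix (Fin N) (Fin N) ℂ) * B).trace.re] ≤ c * M ^ 2)
    (hVB : ∀ B : Matrix (Fin N) (Fin N) ℂ, matrixOpNorm B ≤ b → ∀ Δ : Matrix (Fin N) (Fin N) ℂ,
      Var[fun g : Matrix.specialUnitaryGroup (Fin N) ℂ =>
          (N : ℝ) * ((g : Matrix (Fin N) (Fin N) ℂ) * Δ).trace.re;
        (haarProbability (Matrix.specialUnitaryGroup (Fin N) ℂ)).tilted
          fun g => (N : ℝ) * ((g : Matrix (Fin N) (Fin N) ℂ) * B).trace.re] ≤ v * frobNorm Δ ^ 2)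
    (hρ : 6 * ((d : ℝ) - 1) * |β| * (exp ε₀ * Real.sqrt (c * v)) + exp (ε₀ / 2) * Real.sqrt c * ε₁ ≤ ρ)
    (hhalf : 1 / 2 ≤ ρ) (hρ1 : ρ < 1)
    {W : Potential (ZdEdge d) (Matrix.specialUnitaryGroup (Fin N) ℂ)}
    {supp : Finset (ZdEdge d) → Finset (Finset (ZdEdge d))} (hmem : MemBallZd ε₀ ε₁ R W supp)
    {V : Potential (ZdEdge d) (Matrix.specialUnitaryGroup (Fin N) ℂ)} (hV : V.IsAdapted)
    (hVb : ∀ X, ∃ C, ∀ U, |V X U| ≤ C)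
    {suppV : Finset (ZdEdge d) → Finset (Finset (ZdEdge d))} (hsuppV : V.IsSupportedBy suppV)
    {oscV : Finset (ZdEdge d) → ZdEdge d → ℝ} (hoscV : ∀ X, Dobrushin.IsOscBound (V X) (oscV X))
    {bV : ZdEdge d → ℝ} (hbV : ∀ e, ∑ X ∈ (suppV {e}).filter (fun X => e ∈ X), oscV X e ≤ bV e)
    {B : ℝ} (hB : ∀ e, bV e ≤ B) {S : Finset (ZdEdge d)} (hS : ∀ e, e ∉ S → bV e ≤ 0)
    {μ ν : Measure (LGConfig d (Matrix.specialUnitaryGroup (Fin N) ℂ))}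
    (hμ : μ ∈ perturbedGibbsMeasures (d := d) (fundamentalRep (Fin N)) (N * β) W supp)
    (hν : ν ∈ perturbedGibbsMeasures (d := d) (fundamentalRep (Fin N)) (N * β) (W + V)
      (fun Λ => supp Λ ∪ suppV Λ))
    {F : LGConfig d (Matrix.specialUnitaryGroup (Fin N) ℂ) → ℝ} {Λ : Finset (ZdEdge d)} {KF : ℝ≥0}
    (hF : IsLipschitzCylinder (fundamentalRep (Fin N)) F Λ KF) :
    |(∫ σ, F σ ∂μ) - ∫ σ, F σ ∂ν| ≤
      Real.sqrt N * min B 4 / (1 - ρ) * exp (-((1 - ρ) / max 1 R) * setDistEdges Λ S) * (Λ.card * KF) := by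
  have key := localScreening_of_pair hd hN hc hv hb hP hVB hρ hρ1 hmem hV hVb hsuppV hoscV hbV hB hS hμ hν hF
  refine key.trans ?_
  have hd0 : 0 < d := hd
  have hbV0 : ∀ e, 0 ≤ bV e := fun e =>
    (Finset.sum_nonneg fun X _ => (hoscV X).nonneg e).trans (hbV e)
  have hB0 : 0 ≤ min B 4 := le_min ((hbV0 (0, ⟨0, hd0⟩)).trans (hB _)) (by norm_num)
  have hlin := screeningBound_linear (A := Real.sqrt N / 2) (m := min B 4) (R := R) (by positivity) hB0 hhalf hρ1
    (setDistEdges_nonneg Λ S)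
  have hΛK : (0 : ℝ) ≤ Λ.card * KF := by positivity
  calc _ ≤ 2 * (Real.sqrt N / 2) * min B 4 / (1 - ρ) * exp (-((1 - ρ) / max 1 R) * setDistEdges Λ S) *
        (Λ.card * KF) := mul_le_mul_of_nonneg_right hlin hΛK
    _ = _ := by ring

/-! ### `SU(2)`, every `d`: the closed form (sharp one-link Poincaré constant `2/3`) -/

/-- **`SU(2)`, EVERY `d`, HYPOTHESIS-FREE — screening of local sources uniformly on the tier-1 ball.**
`2(d−1)|β_W| e^{ε₀} + e^{ε₀/2} √(2/3) ε₁ ≤ ρ`, `1/2 ≤ ρ < 1`: for every member of `MemBallZd ε₀ ε₁ R` at bare coupling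
`β_W/2` ('t Hooft `β_W/4`), every bounded source `V` on the finite link set `S` (loads `≤ B`, any strength and range),
every DLR state `μ` of the member and `ν` of `W + V`, every Lipschitz cylinder `F` (`Λ`, `K_F`):
`|∫ F dμ − ∫ F dν| ≤ √2 · min(B,4)/(1 − ρ) · e^{−((1−ρ)/max(1,R)) d(Λ,S)} · #Λ · K_F`. -/
theorem su2_localScreening (hd : 1 ≤ d) {βW ε₀ ε₁ ρ R : ℝ}
    (hρ : 2 * ((d : ℝ) - 1) * |βW| * exp ε₀ + exp (ε₀ / 2) * Real.sqrt (2 / 3) * ε₁ ≤ ρ) (hhalf : 1 / 2 ≤ ρ)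
    (hρ1 : ρ < 1)
    {W : Potential (ZdEdge d) (Matrix.specialUnitaryGroup (Fin 2) ℂ)}
    {supp : Finset (ZdEdge d) → Finset (Finset (ZdEdge d))} (hmem : MemBallZd ε₀ ε₁ R W supp)
    {V : Potential (ZdEdge d) (Matrix.specialUnitaryGroup (Fin 2) ℂ)} (hV : V.IsAdapted)
    (hVb : ∀ X, ∃ C, ∀ U, |V X U| ≤ C)
    {suppV : Finset (ZdEdge d) → Finset (Finset (ZdEdge d))} (hsuppV : V.IsSupportedBy suppV)
    {oscV : Finset (ZdEdge d) → ZdEdge d → ℝ} (hoscV : ∀ X, Dobrushin.IsOscBound (V X) (oscV X))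
    {bV : ZdEdge d → ℝ} (hbV : ∀ e, ∑ X ∈ (suppV {e}).filter (fun X => e ∈ X), oscV X e ≤ bV e)
    {B : ℝ} (hB : ∀ e, bV e ≤ B) {S : Finset (ZdEdge d)} (hS : ∀ e, e ∉ S → bV e ≤ 0)
    {μ ν : Measure (LGConfig d (Matrix.specialUnitaryGroup (Fin 2) ℂ))}
    (hμ : μ ∈ perturbedGibbsMeasures (d := d) (fundamentalRep (Fin 2)) (2 * (βW / 4)) W supp)
    (hν : ν ∈ perturbedGibbsMeasures (d := d) (fundamentalRep (Fin 2)) (2 * (βW / 4)) (W + V)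
      (fun Λ => supp Λ ∪ suppV Λ))
    {F : LGConfig d (Matrix.specialUnitaryGroup (Fin 2) ℂ) → ℝ} {Λ : Finset (ZdEdge d)} {KF : ℝ≥0}
    (hF : IsLipschitzCylinder (fundamentalRep (Fin 2)) F Λ KF) :
    |(∫ σ, F σ ∂μ) - ∫ σ, F σ ∂ν| ≤
      Real.sqrt 2 * min B 4 / (1 - ρ) * exp (-((1 - ρ) / max 1 R) * setDistEdges Λ S) * (Λ.card * KF) := by
  have hc : (0 : ℝ) ≤ 2 / 3 := by norm_num
  have hP : ∀ B : Matrix (Fin 2) (Fin 2) ℂ, matrixOpNorm B ≤ |βW / 4| * (2 * ((d : ℝ) - 1)) →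
      ∀ (ψ : Matrix.specialUnitaryGroup (Fin 2) ℂ → ℝ) (M : ℝ), 0 ≤ M →
        (∀ x y, |ψ x - ψ y| ≤ M * suFrobDist x y) →
        Var[ψ; (haarProbability (Matrix.specialUnitaryGroup (Fin 2) ℂ)).tilted
          fun g => ((2 : ℕ) : ℝ) * ((g : Matrix (Fin 2) (Fin 2) ℂ) * B).trace.re] ≤ 2 / 3 * M ^ 2 :=
    fun B hB ψ M hM hψ => oneLinkPoincareSUN_two_sharp _ B hB ψ M hM hψ
  have hVB := linVariance_of_poincare (N := 2) hP
  have hv : (0 : ℝ) ≤ 2 / 3 * ((2 : ℕ) : ℝ) ^ 2 := by norm_num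
  have hρ' : 6 * ((d : ℝ) - 1) * |βW / 4| * (exp ε₀ * Real.sqrt (2 / 3 * (2 / 3 * ((2 : ℕ) : ℝ) ^ 2))) +
      exp (ε₀ / 2) * Real.sqrt (2 / 3) * ε₁ ≤ ρ := by
    have hsq : Real.sqrt (2 / 3 * (2 / 3 * ((2 : ℕ) : ℝ) ^ 2)) = 4 / 3 := by
      rw [show (2 / 3 * (2 / 3 * ((2 : ℕ) : ℝ) ^ 2) : ℝ) = (4 / 3) ^ 2 by norm_num, Real.sqrt_sq (by norm_num)]
    rw [hsq]
    have e : 6 * ((d : ℝ) - 1) * |βW / 4| * (exp ε₀ * (4 / 3)) = 2 * ((d : ℝ) - 1) * |βW| * exp ε₀ := by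
      rw [abs_div, abs_of_pos (by norm_num : (0 : ℝ) < 4)]
      ring
    rw [e]
    exact hρ
  have key := localScreening_of_pair_linear hd (by norm_num) hc hv le_rfl hP hVB hρ' hhalf hρ1 hmem hV hVb hsuppV
    hoscV hbV hB hS (μ := μ) (ν := ν) (by simpa using hμ) (by simpa using hν) hF
  simpa using key

/-- The `d = 4` reading: `6|β_W| e^{ε₀} + e^{ε₀/2} √(2/3) ε₁ ≤ ρ`, `1/2 ≤ ρ < 1 ⇒`
`|∫ F dμ − ∫ F dν| ≤ √2 · min(B,4)/(1 − ρ) · e^{−((1−ρ)/max(1,R)) d(Λ,S)} · #Λ · K_F` for every member of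
`MemBallZd ε₀ ε₁ R` on `ℤ⁴`, every bounded source on `S`, every pair of DLR states. -/
theorem su2_localScreening_dim4 {βW ε₀ ε₁ ρ R : ℝ}
    (hρ : 6 * |βW| * exp ε₀ + exp (ε₀ / 2) * Real.sqrt (2 / 3) * ε₁ ≤ ρ) (hhalf : 1 / 2 ≤ ρ) (hρ1 : ρ < 1)
    {W : Potential (ZdEdge 4) (Matrix.specialUnitaryGroup (Fin 2) ℂ)}
    {supp : Finset (ZdEdge 4) → Finset (Finset (ZdEdge 4))} (hmem : MemBallZd ε₀ ε₁ R W supp)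
    {V : Potential (ZdEdge 4) (Matrix.specialUnitaryGroup (Fin 2) ℂ)} (hV : V.IsAdapted)
    (hVb : ∀ X, ∃ C, ∀ U, |V X U| ≤ C)
    {suppV : Finset (ZdEdge 4) → Finset (Finset (ZdEdge 4))} (hsuppV : V.IsSupportedBy suppV)
    {oscV : Finset (ZdEdge 4) → ZdEdge 4 → ℝ} (hoscV : ∀ X, Dobrushin.IsOscBound (V X) (oscV X))
    {bV : ZdEdge 4 → ℝ} (hbV : ∀ e, ∑ X ∈ (suppV {e}).filter (fun X => e ∈ X), oscV X e ≤ bV e)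
    {B : ℝ} (hB : ∀ e, bV e ≤ B) {S : Finset (ZdEdge 4)} (hS : ∀ e, e ∉ S → bV e ≤ 0)
    {μ ν : Measure (LGConfig 4 (Matrix.specialUnitaryGroup (Fin 2) ℂ))}
    (hμ : μ ∈ perturbedGibbsMeasures (d := 4) (fundamentalRep (Fin 2)) (2 * (βW / 4)) W supp)
    (hν : ν ∈ perturbedGibbsMeasures (d := 4) (fundamentalRep (Fin 2)) (2 * (βW / 4)) (W + V)
      (fun Λ => supp Λ ∪ suppV Λ))
    {F : LGConfig 4 (Matrix.specialUnitaryGroup (Fin 2) ℂ) → ℝ} {Λ : Finset (ZdEdge 4)} {KF : ℝ≥0}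
    (hF : IsLipschitzCylinder (fundamentalRep (Fin 2)) F Λ KF) :
    |(∫ σ, F σ ∂μ) - ∫ σ, F σ ∂ν| ≤
      Real.sqrt 2 * min B 4 / (1 - ρ) * exp (-((1 - ρ) / max 1 R) * setDistEdges Λ S) * (Λ.card * KF) :=
  su2_localScreening (by norm_num) (by
    have h6 : (2 : ℝ) * (((4 : ℕ) : ℝ) - 1) = 6 := by norm_num
    rw [h6]; exact hρ) hhalf hρ1 hmem hV hVb hsuppV hoscV hbV hB hS hμ hν hF

/-- **Cell `(β_W; ε₀, ε₁) = (1/8; 1/10, 1/20)`**, row sum `≤ 7/8`: on `MemBallZd (1/10) (1/20) R` at `β_W = 1/8` every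
source on `S` is screened at rate `(1/8)/max(1,R)` with constant `8√2 · min(B,4) · #Λ · K_F`. -/
theorem su2_localScreening_1_8 {R : ℝ}
    {W : Potential (ZdEdge 4) (Matrix.specialUnitaryGroup (Fin 2) ℂ)}
    {supp : Finset (ZdEdge 4) → Finset (Finset (ZdEdge 4))} (hmem : MemBallZd (1 / 10) (1 / 20) R W supp)
    {V : Potential (ZdEdge 4) (Matrix.specialUnitaryGroup (Fin 2) ℂ)} (hV : V.IsAdapted)
    (hVb : ∀ X, ∃ C, ∀ U, |V X U| ≤ C)
    {suppV : Finset (ZdEdge 4) → Finset (Finset (ZdEdge 4))} (hsuppV : V.IsSupportedBy suppV)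
    {oscV : Finset (ZdEdge 4) → ZdEdge 4 → ℝ} (hoscV : ∀ X, Dobrushin.IsOscBound (V X) (oscV X))
    {bV : ZdEdge 4 → ℝ} (hbV : ∀ e, ∑ X ∈ (suppV {e}).filter (fun X => e ∈ X), oscV X e ≤ bV e)
    {B : ℝ} (hB : ∀ e, bV e ≤ B) {S : Finset (ZdEdge 4)} (hS : ∀ e, e ∉ S → bV e ≤ 0)
    {μ ν : Measure (LGConfig 4 (Matrix.specialUnitaryGroup (Fin 2) ℂ))}
    (hμ : μ ∈ perturbedGibbsMeasures (d := 4) (fundamentalRep (Fin 2)) (2 * ((1 / 8 : ℝ) / 4)) W supp)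
    (hν : ν ∈ perturbedGibbsMeasures (d := 4) (fundamentalRep (Fin 2)) (2 * ((1 / 8 : ℝ) / 4)) (W + V)
      (fun Λ => supp Λ ∪ suppV Λ))
    {F : LGConfig 4 (Matrix.specialUnitaryGroup (Fin 2) ℂ) → ℝ} {Λ : Finset (ZdEdge 4)} {KF : ℝ≥0}
    (hF : IsLipschitzCylinder (fundamentalRep (Fin 2)) F Λ KF) :
    |(∫ σ, F σ ∂μ) - ∫ σ, F σ ∂ν| ≤
      Real.sqrt 2 * min B 4 / (1 - 7 / 8) * exp (-((1 - 7 / 8) / max 1 R) * setDistEdges Λ S) * (Λ.card * KF) := by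
  refine su2_localScreening_dim4 ?_ (by norm_num) (by norm_num) hmem hV hVb hsuppV hoscV hbV hB hS hμ hν hF
  have h1 := exp_le_taylor4 (x := (1 / 10 : ℝ)) (by norm_num) (by norm_num)
  have h2 := exp_le_taylor4 (x := (1 / 10 : ℝ) / 2) (by norm_num) (by norm_num)
  rw [abs_of_nonneg (by norm_num : (0 : ℝ) ≤ 1 / 8)]
  calc 6 * (1 / 8 : ℝ) * exp (1 / 10) + exp (1 / 10 / 2) * Real.sqrt (2 / 3) * (1 / 20)
      ≤ 6 * (1 / 8 : ℝ) * (1 + 1 / 10 + (1 / 10) ^ 2 / 2 + (1 / 10) ^ 3 / 6 + 5 / 96 * (1 / 10) ^ 4) +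
        (1 + 1 / 10 / 2 + (1 / 10 / 2) ^ 2 / 2 + (1 / 10 / 2) ^ 3 / 6 + 5 / 96 * (1 / 10 / 2) ^ 4) *
          (8165 / 10000) * (1 / 20) := by
        gcongr
        · exact sqrt_two_thirds_le
    _ ≤ 7 / 8 := by norm_num

/-! ### The Wilson point: sources on top of the pure `SU(2)` Wilson action on `ℤ⁴` -/

/-- **THE WILSON POINT: ANY LOCAL SOURCE IS SCREENED AT RATE `log 2`.**  For `0 ≤ β_W ≤ 1/12` (bare coupling `β_W/2`),
ANY bounded adapted source `V` (locally listed by `suppV`, loading only the links of the finite set `S`, loads `≤ B`,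
ANY strength and range) on top of the `SU(2)` Wilson action on `ℤ⁴`, every Wilson DLR state `μ`, EVERY DLR state `ν`
of `Wilson + V`, and every Lipschitz cylinder `F` (`Λ`, `K_F`):
`|∫ F dμ − ∫ F dν| ≤ √2 · min(B,4) · 2^{−⌊d(Λ,S)⌋} · #Λ · K_F` (row sum `6β_W ≤ 1/2`, range `0`). -/
theorem su2_wilson_localScreening_upTo_oneTwelfth {βW : ℝ} (h0 : 0 ≤ βW) (h : βW ≤ 1 / 12)
    {V : Potential (ZdEdge 4) (Matrix.specialUnitaryGroup (Fin 2) ℂ)} (hV : V.IsAdapted)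
    (hVb : ∀ X, ∃ C, ∀ U, |V X U| ≤ C)
    {suppV : Finset (ZdEdge 4) → Finset (Finset (ZdEdge 4))} (hsuppV : V.IsSupportedBy suppV)
    {oscV : Finset (ZdEdge 4) → ZdEdge 4 → ℝ} (hoscV : ∀ X, Dobrushin.IsOscBound (V X) (oscV X))
    {bV : ZdEdge 4 → ℝ} (hbV : ∀ e, ∑ X ∈ (suppV {e}).filter (fun X => e ∈ X), oscV X e ≤ bV e)
    {B : ℝ} (hB : ∀ e, bV e ≤ B) {S : Finset (ZdEdge 4)} (hS : ∀ e, e ∉ S → bV e ≤ 0)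
    {μ ν : Measure (LGConfig 4 (Matrix.specialUnitaryGroup (Fin 2) ℂ))}
    (hμ : μ ∈ ymGibbsMeasures (d := 4) (fundamentalRep (Fin 2)) (2 * (βW / 4)))
    (hν : ν ∈ perturbedGibbsMeasures (d := 4) (fundamentalRep (Fin 2)) (2 * (βW / 4)) V suppV)
    {F : LGConfig 4 (Matrix.specialUnitaryGroup (Fin 2) ℂ) → ℝ} {Λ : Finset (ZdEdge 4)} {KF : ℝ≥0}
    (hF : IsLipschitzCylinder (fundamentalRep (Fin 2)) F Λ KF) :
    |(∫ σ, F σ ∂μ) - ∫ σ, F σ ∂ν| ≤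
      Real.sqrt 2 * min B 4 * (1 / 2) ^ ⌊setDistEdges Λ S⌋₊ * (Λ.card * KF) := by
  classical
  -- the modified action `0 + V`, listed by `∅ ∪ suppV`
  have hν' : ν ∈ perturbedGibbsMeasures (d := 4) (fundamentalRep (Fin 2)) (2 * (βW / 4))
      ((0 : Potential (ZdEdge 4) (Matrix.specialUnitaryGroup (Fin 2) ℂ)) + V)
      (fun Λ => (fun _ : Finset (ZdEdge 4) => (∅ : Finset (Finset (ZdEdge 4)))) Λ ∪ suppV Λ) := by
    simpa only [zero_add, Finset.empty_union] using hν
  haveI : SecondCountableTopology (Matrix (Fin 2) (Fin 2) ℂ) :=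
    inferInstanceAs (SecondCountableTopology (Fin 2 → Fin 2 → ℂ))
  haveI : SecondCountableTopology (Matrix.specialUnitaryGroup (Fin 2) ℂ) :=
    Topology.IsEmbedding.subtypeVal.secondCountableTopology
  -- the zero member of the ball `MemBallZd 0 0 0` with the empty support family
  have hmem : MemBallZd (N := 2) (d := 4) 0 0 0 (0 : Potential (ZdEdge 4) (Matrix.specialUnitaryGroup (Fin 2) ℂ))
      (fun _ : Finset (ZdEdge 4) => (∅ : Finset (Finset (ZdEdge 4)))) :=
    memBallZd_zero le_rfl le_rfl (fun e X hX => by simp at hX)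
  obtain ⟨osc, lip, hosc, hlip, hosca, hΛ⟩ := hmem.loads
  have hW : (0 : Potential (ZdEdge 4) (Matrix.specialUnitaryGroup (Fin 2) ℂ)).IsAdapted :=
    fun X => ⟨hmem.dependsOn X, (hmem.continuous X).measurable⟩
  have hWb : ∀ X, ∃ C, ∀ U, |(0 : Potential (ZdEdge 4) (Matrix.specialUnitaryGroup (Fin 2) ℂ)) X U| ≤ C :=
    fun X => ⟨0, fun U => by simp⟩
  have hc : (0 : ℝ) ≤ 2 / 3 := by norm_num
  have hP : ∀ B : Matrix (Fin 2) (Fin 2) ℂ, matrixOpNorm B ≤ |βW / 4| * (2 * (((4 : ℕ) : ℝ) - 1)) →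
      ∀ (ψ : Matrix.specialUnitaryGroup (Fin 2) ℂ → ℝ) (M : ℝ), 0 ≤ M →
        (∀ x y, |ψ x - ψ y| ≤ M * suFrobDist x y) →
        Var[ψ; (haarProbability (Matrix.specialUnitaryGroup (Fin 2) ℂ)).tilted
          fun g => ((2 : ℕ) : ℝ) * ((g : Matrix (Fin 2) (Fin 2) ℂ) * B).trace.re] ≤ 2 / 3 * M ^ 2 :=
    fun B hB ψ M hM hψ => oneLinkPoincareSUN_two_sharp _ B hB ψ M hM hψ
  have hVB := linVariance_of_poincare (N := 2) hP
  have hv : (0 : ℝ) ≤ 2 / 3 * ((2 : ℕ) : ℝ) ^ 2 := by norm_num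
  have hKR := isKRContraction_perturbedYM_SU (d := 4) (by norm_num) (by norm_num) hc hv le_rfl hP hVB hW
    (supp := fun _ => (∅ : Finset (Finset (ZdEdge 4)))) hosc hosca hlip
  -- the row sums: `6 β_W` (Poincaré/variance pair at `ε₀ = ε₁ = 0`)
  have hρ : 6 * (((4 : ℕ) : ℝ) - 1) * |βW / 4| * (exp 0 * Real.sqrt (2 / 3 * (2 / 3 * ((2 : ℕ) : ℝ) ^ 2))) +
      exp (0 / 2) * Real.sqrt (2 / 3) * 0 ≤ 1 / 2 := by
    have hsq : Real.sqrt (2 / 3 * (2 / 3 * ((2 : ℕ) : ℝ) ^ 2)) = 4 / 3 := by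
      rw [show (2 / 3 * (2 / 3 * ((2 : ℕ) : ℝ) ^ 2) : ℝ) = (4 / 3) ^ 2 by norm_num, Real.sqrt_sq (by norm_num)]
    rw [hsq, abs_div, abs_of_nonneg h0, abs_of_pos (by norm_num : (0 : ℝ) < 4), Real.exp_zero]
    norm_num
    linarith
  have hrow : ∀ x, ∑ y ∈ perturbedNbr (fun _ : Finset (ZdEdge 4) => (∅ : Finset (Finset (ZdEdge 4)))) x,
      (exp 0 * Real.sqrt (2 / 3 * (2 / 3 * ((2 : ℕ) : ℝ) ^ 2)) * |βW / 4| * linkInfluence x y +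
        exp (0 / 2) * Real.sqrt (2 / 3) * ∑ X ∈ ((fun _ : Finset (ZdEdge 4) => (∅ : Finset (Finset (ZdEdge 4)))) {x}).filter
          (fun X => x ∈ X), lip X y) ≤ 1 / 2 :=
    fun x => (sum_perturbedNbr_coeff_le (d := 4) (by norm_num) (β := βW / 4) (c := 2 / 3)
      (v := 2 / 3 * ((2 : ℕ) : ℝ) ^ 2) (a := 0) hΛ x).trans hρ
  have hμ' : μ ∈ perturbedGibbsMeasures (d := 4) (fundamentalRep (Fin 2)) (2 * (βW / 4))
      (0 : Potential (ZdEdge 4) (Matrix.specialUnitaryGroup (Fin 2) ℂ)) (fun _ => ∅) := by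
    rw [perturbedGibbsMeasures_zero]; exact hμ
  have key := abs_integral_sub_integral_le_of_source (N := 2) (d := 4) (by norm_num) hW hWb hmem.supportedBy
    hmem.range hKR hrow (by norm_num) hV hVb hsuppV hoscV hbV hB hS (by simpa using hμ') hν' hF.measurable hF.dependsOn
    hF.abs_le (hF.isLipBound zero_le_one (fun a b => by rw [one_mul]; exact dist_suEntries_le_suFrobDist a b))
  have hsum : ∑ y ∈ Λ, (if y ∈ Λ then (1 : ℝ) * (KF : ℝ) else 0) = Λ.card * KF := by
    rw [Finset.sum_ite_of_true (fun y hy => hy), Finset.sum_const, nsmul_eq_mul, one_mul]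
  rw [hsum, max_eq_left (zero_le_one : (0 : ℝ) ≤ 1), div_one] at key
  refine key.trans (le_of_eq ?_)
  have h2 : Real.sqrt ((2 : ℕ) : ℝ) = Real.sqrt 2 := by norm_num
  rw [h2]
  ring

/-! ### Every `N ≥ 2`: the Bakry–Émery pair, hypothesis-free -/

/-- **ALL `N ≥ 2`, EVERY `d ≥ 1`, HYPOTHESIS-FREE — screening of local sources uniformly on the tier-1 ball from the
Bakry–Émery one-link pair** (`b = 2(d−1)|β| < 1/2`):
`6(d−1)|β| e^{ε₀}/(1/2 − b) + e^{ε₀/2} ε₁/√(N(1/2 − b)) ≤ ρ`, `1/2 ≤ ρ < 1 ⇒` for every member of `MemBallZd ε₀ ε₁ R`,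
every bounded source on `S`, every pair of DLR states, every Lipschitz cylinder `F`:
`|∫ F dμ − ∫ F dν| ≤ √N · min(B,4)/(1 − ρ) · e^{−((1−ρ)/max(1,R)) d(Λ,S)} · #Λ · K_F`. -/
theorem suN_localScreening_bakryEmery (hd : 1 ≤ d) (hN : 2 ≤ N) {β ε₀ ε₁ ρ R : ℝ}
    (hb : |β| * (2 * ((d : ℝ) - 1)) < 1 / 2)
    (hρ : 6 * ((d : ℝ) - 1) * |β| * exp ε₀ / (1 / 2 - |β| * (2 * ((d : ℝ) - 1))) +
      exp (ε₀ / 2) * ε₁ / Real.sqrt ((N : ℝ) * (1 / 2 - |β| * (2 * ((d : ℝ) - 1)))) ≤ ρ)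
    (hhalf : 1 / 2 ≤ ρ) (hρ1 : ρ < 1)
    {W : Potential (ZdEdge d) (Matrix.specialUnitaryGroup (Fin N) ℂ)}
    {supp : Finset (ZdEdge d) → Finset (Finset (ZdEdge d))} (hmem : MemBallZd ε₀ ε₁ R W supp)
    {V : Potential (ZdEdge d) (Matrix.specialUnitaryGroup (Fin N) ℂ)} (hV : V.IsAdapted)
    (hVb : ∀ X, ∃ C, ∀ U, |V X U| ≤ C)
    {suppV : Finset (ZdEdge d) → Finset (Finset (ZdEdge d))} (hsuppV : V.IsSupportedBy suppV)
    {oscV : Finset (ZdEdge d) → ZdEdge d → ℝ} (hoscV : ∀ X, Dobrushin.IsOscBound (V X) (oscV X))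
    {bV : ZdEdge d → ℝ} (hbV : ∀ e, ∑ X ∈ (suppV {e}).filter (fun X => e ∈ X), oscV X e ≤ bV e)
    {B : ℝ} (hB : ∀ e, bV e ≤ B) {S : Finset (ZdEdge d)} (hS : ∀ e, e ∉ S → bV e ≤ 0)
    {μ ν : Measure (LGConfig d (Matrix.specialUnitaryGroup (Fin N) ℂ))}
    (hμ : μ ∈ perturbedGibbsMeasures (d := d) (fundamentalRep (Fin N)) (N * β) W supp)
    (hν : ν ∈ perturbedGibbsMeasures (d := d) (fundamentalRep (Fin N)) (N * β) (W + V)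
      (fun Λ => supp Λ ∪ suppV Λ))
    {F : LGConfig d (Matrix.specialUnitaryGroup (Fin N) ℂ) → ℝ} {Λ : Finset (ZdEdge d)} {KF : ℝ≥0}
    (hF : IsLipschitzCylinder (fundamentalRep (Fin N)) F Λ KF) :
    |(∫ σ, F σ ∂μ) - ∫ σ, F σ ∂ν| ≤
      Real.sqrt N * min B 4 / (1 - ρ) * exp (-((1 - ρ) / max 1 R) * setDistEdges Λ S) * (Λ.card * KF) := by
  set b : ℝ := |β| * (2 * ((d : ℝ) - 1)) with hbdef
  have hNpos : (0 : ℝ) < N := by exact_mod_cast (show 0 < N by omega)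
  have hgap : 0 < 1 / 2 - b := by linarith
  have hP := oneLinkPoincareSUN_bakryEmery hN hb
  have hVv := oneLinkVarianceBound_bakryEmery hN hb
  have hc : (0 : ℝ) ≤ 1 / ((N : ℝ) * (1 / 2 - b)) := by positivity
  have hv : (0 : ℝ) ≤ (N : ℝ) / (1 / 2 - b) := by positivity
  refine localScreening_of_pair_linear hd (by omega) hc hv le_rfl (fun B hB => hP B hB) (fun B hB => hVv B hB) ?_
    hhalf hρ1 hmem hV hVb hsuppV hoscV hbV hB hS hμ hν hF
  have hsq1 : Real.sqrt (1 / ((N : ℝ) * (1 / 2 - b)) * ((N : ℝ) / (1 / 2 - b))) = 1 / (1 / 2 - b) := by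
    rw [show 1 / ((N : ℝ) * (1 / 2 - b)) * ((N : ℝ) / (1 / 2 - b)) = (1 / (1 / 2 - b)) ^ 2 by field_simp,
      Real.sqrt_sq (by positivity)]
  have hsq2 : Real.sqrt (1 / ((N : ℝ) * (1 / 2 - b))) = 1 / Real.sqrt ((N : ℝ) * (1 / 2 - b)) := by
    rw [Real.sqrt_div' _ (mul_nonneg hNpos.le hgap.le), Real.sqrt_one]
  rw [hsq1, hsq2]
  calc 6 * ((d : ℝ) - 1) * |β| * (exp ε₀ * (1 / (1 / 2 - b))) + exp (ε₀ / 2) * (1 / Real.sqrt ((N : ℝ) * (1 / 2 - b))) * ε₁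
      = 6 * ((d : ℝ) - 1) * |β| * exp ε₀ / (1 / 2 - b) + exp (ε₀ / 2) * ε₁ / Real.sqrt ((N : ℝ) * (1 / 2 - b)) := by
        ring
    _ ≤ ρ := hρ

end Summit.Ventures.YMGap.RobustBall

end
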